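import Summits.NavierStokesRegularity.NavierStokesRegularity.Theses.QuantisedSymmetry
import Summits.NavierStokesRegularity.NavierStokesRegularity.Theses.Blowup
import Summits.NavierStokesRegularity.NavierStokesRegularity.Theorems.QuantisedSymmetryPolyhedralTruncationBridge
import Summits.NavierStokesRegularity.NavierStokesRegularity.Theorems.QuantisedSymmetryPolyhedralDssProfileExistsDominatesBlowupProfile
import Summits.NavierStokesRegularity.NavierStokesRegularity.Theorems.QuantisedSymmetryPolyhedralDssProfileExistsOfCell
import Summits.NavierStokesRegularity.NavierStokesRegularity.Theorems.DssFarFieldSlavingDssTruncationBridge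
import Summits.NavierStokesRegularity.NavierStokesRegularity.Theorems.SoloInformedClayDichotomy
import HarnessLib

/-!
# Strategist sketch S14 gen 12 — crux `PolyhedralDssProfileExists` (stmt-NavierStokesRegularity-1404)

Typed companion of `STRATEGY-CENSUS-s14.md` (second independent census, family `s`, gen 12).
Everything here is either a `def … : Prop` (a candidate piece / intermediate, stated, NOT asserted)
or a sorry-free theorem assembled from landed tree theorems.  No `sorry`.

Contents
* §1 `crux_decides`, `crux_gives_clayC` — the crux ALONE refutes Clay (A) and proves Clay (C):
  tree theorems `QuantisedSymmetry.closes` + `quantisedSymmetry_polyhedralTruncationBridge_proof`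
  + `ClayUniqueness_holds` + `navierStokesRegularity_or_breakdownR3`.
* §2 weaker intermediates from the summit statement: `W1 := Blowup.BlowupTypeIDssProfile`
  (drop the symmetry; `weaker_of_crux`, `weaker_decides` — W1 already decides the summit, every
  arrow a tree theorem), `W2 := FiniteTimeBlowupExists` (drop DSS/Type I; `w2_of_w1`, `w2_decides`).
* §3 decomposition attempts: D_cpt (approximate cells + compactness) with the COLLAPSE theorem
  `approx_of_exact` (the ∃-piece is implied by the crux, so the split is `A ↔ X` modulo the provable
  compactness piece `CompactnessPiece`); D_NK (abstract Newton–Kantorovich, `AbstractNewtonKantorovich`,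
  provable; its certificate piece is not typeable before the period map is a DEFINED Banach-space map,
  and is empty without a numerical candidate).
* §4 strengthening `MirrorPolyhedralDssProfileExists` (full polyhedral group incl. a reflection) with
  `crux_of_sPlus`.
-/

noncomputable section

set_option linter.dupNamespace false
set_option linter.unusedVariables false

namespace Summit.NavierStokesRegularity.NavierStokesRegularity.Cruxes.PolyhedralDssProfileExists.S14g12

open MeasureTheory Set Function Filter Topology
open Literature.Analysis.FluidPDE
open _root_.Summit.NavierStokesRegularity.NavierStokesRegularity.Theses

local notation "ℝ³" => EuclideanSpace ℝ (Fin 3)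

/-! ## §1  The crux alone decides the summit (negatively) -/

/-- `X := PolyhedralDssProfileExists` refutes Clay (A): the route's deciding theorem with its two
other binders discharged by landed theorems. -/
theorem crux_decides (hX : QuantisedSymmetry.PolyhedralDssProfileExists) : ¬ _root_.NavierStokesRegularity :=
  QuantisedSymmetry.closes hX
    _root_.Summit.NavierStokesRegularity.NavierStokesRegularity.Theorems.quantisedSymmetry_polyhedralTruncationBridge_proof
    QuantisedSymmetry.ClayUniqueness_holds

/-- … and therefore proves Clay (C) (board rule D-0052), via the landed dichotomy (A) ∨ (C). -/
theorem crux_gives_clayC (hX : QuantisedSymmetry.PolyhedralDssProfileExists) :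
    _root_.Literature.Analysis.FluidPDE.NavierStokesBreakdownR3 :=
  (_root_.Summit.NavierStokesRegularity.NavierStokesRegularity.Theorems.navierStokesRegularity_or_breakdownR3).resolve_left
    (crux_decides hX)

/-! ## §2  Weaker intermediates read off the summit statement -/

/-- W1: drop the symmetry group — the sector-free Type-I (rotated) DSS profile, i.e. the negation of
Tsai's Type-I DSS Liouville wall = route `Blowup` crux #5 (stmt-0155). -/
abbrev W1 : Prop := Blowup.BlowupTypeIDssProfile

/-- `X ⇒ W1` (landed: `stub_dominatesBlowupProfile`, p156644). -/
theorem weaker_of_crux (hX : QuantisedSymmetry.PolyhedralDssProfileExists) : W1 :=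
  _root_.Summit.NavierStokesRegularity.NavierStokesRegularity.Theorems.PolyhedralDssProfileExists.PolyhedralCell.stub_dominatesBlowupProfile hX

/-- W2: drop DSS and Type I as well — a rapidly decaying datum whose Leray–Hopf classical solution
has finite maximal lifespan (X5a of route `Blowup`). -/
def FiniteTimeBlowupExists : Prop :=
  ∃ ν : ℝ, 0 < ν ∧ ∃ T : ℝ, 0 < T ∧ ∃ (u : ℝ → ℝ³ → ℝ³) (p : ℝ → ℝ³ → ℝ),
    IsMaximalSmoothSolution ν 0 u p T ∧ IsLerayHopfOn T ν 0 (u 0) u ∧ HasRapidSpatialDecay (u 0)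

/-- `W1 ⇒ W2`: the sector-free truncation bridge is a tree theorem (`dssTruncationBridge_proof`,
stmt-14477, resting on `filamentSkeletonRss_rdssProfileTruncation_proof`). -/
theorem w2_of_w1 (hW : W1) : FiniteTimeBlowupExists :=
  _root_.Summit.NavierStokesRegularity.NavierStokesRegularity.Theorems.dssTruncationBridge_proof hW

/-- `W2 ⇒ ¬(A)`: Clay (A) on the datum, glued by `ClayUniqueness_holds`, extends the maximal solution
past its lifespan (the `closes` argument, verbatim). -/
theorem w2_decides (hW : FiniteTimeBlowupExists) : ¬ _root_.NavierStokesRegularity := by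
  rintro hA
  obtain ⟨ν, hν, T, hT, u, p, ⟨hcl, hmax⟩, hLH, hdecay⟩ := hW
  have h0 : (0 : ℝ) ∈ Set.Ico 0 T := ⟨le_rfl, hT⟩
  obtain ⟨u', p', hu', hp', hns, hbe⟩ :=
    hA ν hν (u 0) (hcl.contDiff_velocity h0) (hcl.divFree 0 h0) hdecay
  have heq : ∀ t ∈ Set.Ico 0 T, u' t = u t :=
    QuantisedSymmetry.ClayUniqueness_holds ν hν (u 0) hdecay u' u p' p T hT hu' hp' hns hbe hcl hLH rfl
  have hcl' : IsClassicalNSSolutionOn (Set.Ici 0) ν 0 u' p' :=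
    ⟨hu', hp', fun t ht x => hns.momentum t ht x, fun t ht => hns.divFree t ht⟩
  refine hmax ⟨T + 1, by linarith, u', p', ?_, heq⟩
  exact hcl'.mono (fun t ht => ht.1) (uniqueDiffOn_Ico 0 (T + 1))

/-- `W1 ⇒ ¬(A)`: the weakest typed intermediate with computable structure already decides the
summit — so replacing the crux by W1 is a route MERGE into `Blowup`/`DssFarFieldSlaving`, not a strategy. -/
theorem weaker_decides (hW : W1) : ¬ _root_.NavierStokesRegularity :=
  w2_decides (w2_of_w1 hW)

/-- The summit-down ladder in one line: `X ⇒ W1 ⇒ W2 ⇒ ¬(A)`. -/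
theorem ladder_decides (hX : QuantisedSymmetry.PolyhedralDssProfileExists) : ¬ _root_.NavierStokesRegularity :=
  weaker_decides (weaker_of_crux hX)

/-! ## §3  Decomposition attempts -/

/-- The group clause of the crux: finite, proper rotations, irreducible on `ℝ³` (T/O/I). -/
def IsPolyhedralGroup (G : Subgroup (ℝ³ ≃ₗᵢ[ℝ] ℝ³)) : Prop :=
  Finite G ∧ (∀ g ∈ G, LinearMap.det (g.toLinearEquiv : ℝ³ →ₗ[ℝ] ℝ³) = 1) ∧
    (∀ V : Submodule ℝ ℝ³, (∀ g ∈ G, ∀ v ∈ V, g v ∈ V) → V = ⊥ ∨ V = ⊤)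

/-- An `ε`-APPROXIMATE `G`-cell on the model period `[-1, -c⁻²]` with a Type-I envelope `M/(1+|x|)`:
every clause of the line's `PolyhedralCellExists` except that the zoom junction holds only up to `ε`
in sup norm. (`ε = 0` is an exact cell with envelope.) -/
def IsApproxCell (G : Subgroup (ℝ³ ≃ₗᵢ[ℝ] ℝ³)) (c M ε : ℝ) (v : ℝ → ℝ³ → ℝ³) : Prop :=
  ContinuousOn (Function.uncurry v) (Set.Icc (-1 : ℝ) (-(c ^ 2)⁻¹) ×ˢ Set.univ) ∧
  (∀ t ∈ Set.Icc (-1 : ℝ) (-(c ^ 2)⁻¹), ∀ x, ‖v t x‖ ≤ M / (1 + ‖x‖)) ∧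
  (∀ t ∈ Set.Icc (-1 : ℝ) (-(c ^ 2)⁻¹), IsWeaklyDivFree (v t)) ∧
  (∀ s t : ℝ, -1 ≤ s → s < t → t ≤ -(c ^ 2)⁻¹ → ∀ x,
      v t x = heatFlow (v s) (t - s) x - oseenDuhamel 1 s v v t x) ∧
  (∀ x, ‖v (-(c ^ 2)⁻¹) x - c • v (-1) (c • x)‖ ≤ ε) ∧
  (∀ g ∈ G, ∀ t ∈ Set.Icc (-1 : ℝ) (-(c ^ 2)⁻¹), ∀ x, v t (g x) = g (v t x))

/-- Exact polyhedral cell with Type-I envelope and an amplitude floor at a marked point. -/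
def ExactTypeICellExists : Prop :=
  ∃ G : Subgroup (ℝ³ ≃ₗᵢ[ℝ] ℝ³), IsPolyhedralGroup G ∧ ∃ c : ℝ, 1 < c ∧ ∃ M : ℝ, ∃ x₀ : ℝ³, ∃ a : ℝ, 0 < a ∧
    ∃ v : ℝ → ℝ³ → ℝ³, IsApproxCell G c M 0 v ∧ a ≤ ‖v (-1) x₀‖

/-- Piece A of the compactness split D_cpt: approximate cells at EVERY precision with UNIFORM data
`(G, c, M, x₀, a)`. -/
def ApproxTypeICells : Prop :=
  ∃ G : Subgroup (ℝ³ ≃ₗᵢ[ℝ] ℝ³), IsPolyhedralGroup G ∧ ∃ c : ℝ, 1 < c ∧ ∃ M : ℝ, ∃ x₀ : ℝ³, ∃ a : ℝ, 0 < a ∧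
    ∀ ε : ℝ, 0 < ε → ∃ v : ℝ → ℝ³ → ℝ³, IsApproxCell G c M ε v ∧ a ≤ ‖v (-1) x₀‖

/-- Piece B of D_cpt (provable, size L: KNSS Prop. 4.1 smoothing on the period ⇒ local `C^k` bounds
uniform in `ε`; Arzelà–Ascoli on compacts; dominated convergence in the Oseen formula under the
uniform envelope; the junction and equivariance pass to the limit; the floor at `x₀` survives locally
uniform convergence).  Stated, not proved here. -/
def CompactnessPiece : Prop := ApproxTypeICells → ExactTypeICellExists

/-- **COLLAPSE of D_cpt**: the ∃-piece is implied by the exact statement (take the constant family).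
Hence, modulo the provable `CompactnessPiece`, `ApproxTypeICells ↔ ExactTypeICellExists` — the split
does not separate anything from the crux's ∃-content. -/
theorem approx_of_exact (h : ExactTypeICellExists) : ApproxTypeICells := by
  obtain ⟨G, hG, c, hc, M, x₀, a, ha, v, hv, hfloor⟩ := h
  refine ⟨G, hG, c, hc, M, x₀, a, ha, fun ε hε => ⟨v, ?_, hfloor⟩⟩
  obtain ⟨h1, h2, h3, h4, h5, h6⟩ := hv
  exact ⟨h1, h2, h3, h4, fun x => (h5 x).trans hε.le, h6⟩

/-- The assembled split, for the record: A ∧ B ⇒ exact cell. -/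
theorem exact_of_pieces (hA : ApproxTypeICells) (hB : CompactnessPiece) : ExactTypeICellExists := hB hA

/-- D_NK, the provable half: an abstract Newton–Kantorovich / radii-polynomial theorem on a real Banach
space (contraction of the preconditioned Newton map on a closed ball). Provable from Mathlib's
contraction-mapping theorem; stated here as the shape the CERTIFICATE piece would have to feed. -/
def AbstractNewtonKantorovich : Prop :=
  ∀ (E : Type) [NormedAddCommGroup E] [NormedSpace ℝ E] [CompleteSpace E]
    (F : E → E) (A : E →L[ℝ] E) (x₀ : E) (r ρ κ : ℝ),
    0 ≤ r → 0 < ρ → 0 ≤ κ → κ < 1 →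
    ‖A (F x₀)‖ ≤ r →
    (∀ x ∈ Metric.closedBall x₀ ρ, ∀ y ∈ Metric.closedBall x₀ ρ,
        ‖(x - A (F x)) - (y - A (F y))‖ ≤ κ * ‖x - y‖) →
    r + κ * ρ ≤ ρ →
    Function.Injective A →
    ∃ x ∈ Metric.closedBall x₀ ρ, F x = 0

/-! ## §4  Strengthening -/

/-- S⁺: a profile equivariant under a finite irreducible rotation group AND one improper isometry
(mirror / inversion): the full polyhedral groups `T_d, T_h, O_h, I_h` sector (Kida–Pelz high-symmetry
class).  More rigid (15 mirror walls for `O_h`: tangential flow, wall-normal vorticity), still no engine. -/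
def MirrorPolyhedralDssProfileExists : Prop :=
  ∃ G : Subgroup (ℝ³ ≃ₗᵢ[ℝ] ℝ³), IsPolyhedralGroup G ∧
    ∃ σ : ℝ³ ≃ₗᵢ[ℝ] ℝ³, LinearMap.det (σ.toLinearEquiv : ℝ³ →ₗ[ℝ] ℝ³) = -1 ∧
    ∃ c : ℝ, 1 < c ∧ ∃ u : ℝ → ℝ³ → ℝ³,
      IsAncientMildSolution 1 u ∧ (∀ t < 0, AEStronglyMeasurable (u t) volume) ∧
      IsDiscretelySelfSimilar c u ∧ (∃ C₀ : ℝ, HasTypeIDecay C₀ u) ∧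
      (∀ g ∈ G, ∀ t x, u t (g x) = g (u t x)) ∧ (∀ t x, u t (σ x) = σ (u t x)) ∧
      ¬ (∀ t < 0, u t =ᵐ[volume] 0)

/-- `S⁺ ⇒ X` (forget the mirror). -/
theorem crux_of_sPlus (h : MirrorPolyhedralDssProfileExists) : QuantisedSymmetry.PolyhedralDssProfileExists := by
  obtain ⟨G, ⟨hfin, hdet, hirr⟩, σ, -, c, hc, u, hanc, hmeas, hdss, hdec, hG, -, hnt⟩ := h
  exact ⟨G, hfin, hdet, hirr, c, hc, u, hanc, hmeas, hdss, hdec, hG, hnt⟩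

end Summit.NavierStokesRegularity.NavierStokesRegularity.Cruxes.PolyhedralDssProfileExists.S14g12

end
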